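import Literature.AlgebraicGeometry.Motives.HodgeLieWeightOneRankFourSplitting
import HarnessLib

/-!
# Weight-one Hodge structures with Hodge group of rank four, not of CM type. E: `φ³ = qφ` with `q ∈ ℚ_{<0}`,
# and the Hodge decomposition of `range φ` by the eigenvalues `±μ` (`μ² = q`) of `φ_ℂ`

Family `hodge`, layer `Literature/AlgebraicGeometry/Motives`; THEOREMS ONLY (no definition, no named fact; D-0026).
Fifth file of the lane MT-RANK-FIVE of the cell `pub-hodgecm2` (setting as in `Motives/HodgeLieWeightOneRankFourBlocks`,
with `dim_ℚ 𝔥 = 4`, `X ∈ 𝔥 ∖ End_Hdg(V)`; `φ` the rational central element, `Φ = φ_ℂ`, `[E, F] = α(2P−1) + βΦ`, `β ≠ 0`,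
`Φ E = Φ F = 0` from `Motives/HodgeLieWeightOneRankFourSplitting`).

* `eq_zero_of_skew_hodge_sq_eq_zero` — a Hodge endomorphism lying in `𝔥` (so `ψ`-skew) with square zero vanishes
  (second Hodge–Riemann relation).
* `exists_ratCast_eq_of_baseChange_eq_smul` — if `T_ℂ = c • S_ℂ` for rational `T, S` with `S ≠ 0` then `c ∈ ℚ`.
* `exists_rat_central_cube` — **`α ≠ 0`; `E F = αP + βΦP`, `F E = α(1−P) − βΦ(1−P)`; `Φ² = μ Φ (2P−1)` with
  `μ = −α/β`; `φ³ = qφ` with `q = μ² ∈ ℚ` and `q < 0`; the `μ`-eigenvectors of `Φ` lie in `V^{1,0}` and the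
  `(−μ)`-eigenvectors in `V^{0,1}`.**  (`Φ(E F) = 0 = Φ(F E)` gives `βΦ²P = −αΦP`, `βΦ²(1−P) = αΦ(1−P)`; `α = 0` would
  force `Φ² = 0`, hence `φ = 0` by Hodge–Riemann; `q ∈ ℚ` since `φ³` and `φ` are rational; `q < 0` by Hodge–Riemann at
  `y = P Φ v ≠ 0`: `i ψ_ℂ(Φy, \overline{Φy}) = −q · i ψ_ℂ(y, ȳ)` with both sides positive.)

Classically: `range φ` is the part of `V` on which `Hg` acts through its centre `U(1)`; it is a Hodge structure with
complex multiplication by the imaginary quadratic field `ℚ(φ) ≅ ℚ(√q)`, `V''^{1,0}` being the `μ`-eigenspace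
(Moonen–Zarhin 1999 §2; Deligne, LNM 900, I Ex. 3.7).

## References

* [MoonenZarhin1999LowDim] B. Moonen, Yu. Zarhin, *Hodge classes on abelian varieties of low dimension*, Math. Ann. 315
  (1999), §2.
* [Deligne1982HodgeCycles] P. Deligne, *Hodge cycles on abelian varieties*, LNM 900 (1982), I §3, Ex. 3.7.
* [Huybrechts2016K3] D. Huybrechts, *Lectures on K3 Surfaces* (2016), Thm. 3.3.9 (proof, p. 67: `Hg ⊆ Sp(ψ)`).
* [FultonHarris1991] W. Fulton, J. Harris, *Representation Theory*, GTM 129 (1991), Lecture 11 (§11.1).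
-/

noncomputable section

open scoped TensorProduct

namespace Literature.AlgebraicGeometry.Motives

universe u

namespace HodgeStructure

open ProjectorBlocks

variable {V : Type u} [AddCommGroup V] [Module ℚ V] [Module.Finite ℚ V] [HodgeTensorFacts.{u, u}] {n : ℤ}
  {S : Type u} [Fintype S] [DecidableEq S] {deg : S → ℤ}

/-! ## §1 Two lemmas: Hodge–Riemann kills skew nilpotents of order two; rationality of a scalar -/

/-- **A Hodge endomorphism in `Lie Hg` with square zero is zero** (weight one, degrees in `{0,1}`, `ψ` a polarization):
`a ∈ 𝔥` is `ψ`-skew and `a_ℂ` commutes with `P` (`a ∈ End_Hdg`), so for `y = P v` or `(1−P) v` with `a_ℂ y ≠ 0` the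
vector `x = a_ℂ y` is of pure type and `ψ_ℂ(x, x̄) = −ψ_ℂ(y, a_ℂ² ȳ) = 0`, against the second Hodge–Riemann relation.
[cite: Huybrechts2016K3, Thm. 3.3.9 (proof, p. 67)] [cite: MoonenZarhin1999LowDim, §2] -/
theorem eq_zero_of_skew_hodge_sq_eq_zero (H : HodgeStructure V n) (ψ : H.Polarization) (hn : n = 1)
    (e : Module.Basis S ℂ (ℂ ⊗[ℚ] V)) (hF : ∀ a, H.F a = Submodule.span ℂ (e '' {σ | a ≤ deg σ}))
    (hFc : ∀ a, complexConj (H.F a) = Submodule.span ℂ (e '' {σ | deg σ ≤ n - a}))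
    (hdeg : ∀ σ, deg σ = 0 ∨ deg σ = 1) {a : Module.End ℚ V} (ha : a ∈ H.hodgeLie)
    (haP : a.baseChange ℂ * gradingEnd e deg = gradingEnd e deg * a.baseChange ℂ) (hsq : a * a = 0) : a = 0 := by
  classical
  subst hn
  set P := gradingEnd e deg with hP
  set A := a.baseChange ℂ with hA
  have hAA : A * A = 0 := by rw [hA, ← LinearMap.baseChange_mul, hsq, LinearMap.baseChange_zero]
  have hAM : A ∈ H.hodgeLieC := H.baseChange_mem_hodgeLieC ha
  by_contra ha0
  -- a vector with `A v ≠ 0`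
  obtain ⟨v, hv⟩ : ∃ v, A v ≠ 0 := by
    by_contra h
    push Not at h
    apply ha0
    have hA0 : A = 0 := LinearMap.ext fun v => by rw [h v, LinearMap.zero_apply]
    have hmem : a ∈ (⊥ : Submodule ℚ (Module.End ℚ V)) := by
      apply mem_of_one_tmul_mem_baseChange
      rw [Submodule.baseChange_bot]
      have key : ((1 : ℂ) ⊗ₜ[ℚ] a : ℂ ⊗[ℚ] Module.End ℚ V) = 0 := by
        apply (endBaseChangeEquiv V).injective
        rw [endBaseChangeEquiv_tmul, one_smul, map_zero, ← hA, hA0]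
      rw [key]
      exact Submodule.zero_mem _
    exact (Submodule.mem_bot ℚ).1 hmem
  -- the key computation: `ψ_ℂ(A y, conj (A y)) = 0` for every `y`
  have hzero : ∀ y, ψ.form.baseChange ℂ (A y) (conj (A y)) = 0 := by
    intro y
    rw [hA, conj_baseChange, formBaseChange_skew_of_mem_hodgeLieC ψ hAM y, ← hA, ← Module.End.mul_apply, hAA,
      LinearMap.zero_apply, map_zero, neg_zero]
  -- one of `P (A v)`, `(1 - P) (A v)` is non-zero
  by_cases hPv : P (A v) ≠ 0
  · have hy : A (P v) ≠ 0 := by rw [← Module.End.mul_apply, haP, Module.End.mul_apply]; exact hPv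
    have hmem : A (P v) ∈ H.piece 1 ((1 : ℤ) - 1) := by
      rw [piece_eq_span_of_graded H e hF hFc 1, ← Module.End.mul_apply, haP, Module.End.mul_apply]
      exact gradingEnd_apply_mem_span_one e hdeg _
    obtain ⟨r, hr, hre⟩ := ψ.pos 1 ((1 : ℤ) - 1) (by ring) _ hmem hy
    rw [hzero, mul_zero] at hre
    have hr0 : (r : ℂ) = 0 := hre.symm
    exact hr.ne' (by exact_mod_cast hr0)
  · push Not at hPv
    have hQv : (1 - P) (A v) ≠ 0 := by
      intro h
      apply hv
      have h' : A v = P (A v) + (1 - P) (A v) := by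
        rw [LinearMap.sub_apply, Module.End.one_apply, add_sub_cancel]
      rw [h', hPv, h, add_zero]
    have haQ : A * (1 - P) = (1 - P) * A := by rw [mul_sub, sub_mul, mul_one, one_mul, haP]
    have hy : A ((1 - P) v) ≠ 0 := by rw [← Module.End.mul_apply, haQ, Module.End.mul_apply]; exact hQv
    have hmem : A ((1 - P) v) ∈ H.piece 0 ((1 : ℤ) - 0) := by
      rw [piece_eq_span_of_graded H e hF hFc 0, ← Module.End.mul_apply, haQ, Module.End.mul_apply]
      exact one_sub_gradingEnd_apply_mem_span_zero e hdeg _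
    obtain ⟨r, hr, hre⟩ := ψ.pos 0 ((1 : ℤ) - 0) (by ring) _ hmem hy
    rw [hzero, mul_zero] at hre
    have hr0 : (r : ℂ) = 0 := hre.symm
    exact hr.ne' (by exact_mod_cast hr0)

omit [HodgeTensorFacts.{u, u}] [Fintype S] [DecidableEq S] in
/-- **Rationality of a scalar**: if `T_ℂ = c • S_ℂ` for rational endomorphisms `T, S` with `S ≠ 0`, then `c ∈ ℚ`
(evaluate a rational coordinate functional at a vector `v` with `S v ≠ 0`). [cite: Deligne1982HodgeCycles, I §3 (proof of Prop. 3.4)] -/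
theorem exists_ratCast_eq_of_baseChange_eq_smul {T U : Module.End ℚ V} {c : ℂ} (hU : U ≠ 0)
    (h : T.baseChange ℂ = c • U.baseChange ℂ) : ∃ q : ℚ, (q : ℂ) = c := by
  classical
  obtain ⟨v, hv⟩ : ∃ v, U v ≠ 0 := by
    by_contra h'
    push Not at h'
    exact hU (LinearMap.ext fun v => by rw [h' v, LinearMap.zero_apply])
  set b := Module.finBasis ℚ V with hb
  obtain ⟨i, hi⟩ : ∃ i, b.coord i (U v) ≠ 0 := by
    by_contra h'
    push Not at h'
    exact hv (b.ext_elem fun i => by rw [map_zero, Finsupp.zero_apply]; exact h' i)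
  set f : V →ₗ[ℚ] ℚ := b.coord i with hf
  have e1 : ∀ W : Module.End ℚ V, f.baseChange ℂ (W.baseChange ℂ ((1 : ℂ) ⊗ₜ[ℚ] v)) = (1 : ℂ) ⊗ₜ[ℚ] f (W v) := by
    intro W
    rw [LinearMap.baseChange_tmul, LinearMap.baseChange_tmul]
  have h1 := congrArg (fun G : Module.End ℂ (ℂ ⊗[ℚ] V) => f.baseChange ℂ (G ((1 : ℂ) ⊗ₜ[ℚ] v))) h
  simp only [LinearMap.smul_apply, map_smul, e1] at h1
  have h2 := congrArg (TensorProduct.rid ℚ ℂ) h1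
  rw [TensorProduct.smul_tmul', TensorProduct.rid_tmul, TensorProduct.rid_tmul, smul_eq_mul, mul_one,
    Rat.smul_one_eq_cast, Rat.smul_def] at h2
  refine ⟨f (T v) / f (U v), ?_⟩
  rw [Rat.cast_div, h2, mul_div_assoc, mul_div_cancel₀ _ (by exact_mod_cast hi : (f (U v) : ℂ) ≠ 0)]

omit [HodgeTensorFacts.{u, u}] [Fintype S] [DecidableEq S] in
/-- `T_ℂ = 0` implies `T = 0` for a rational endomorphism (`ℚ → ℂ` is faithfully flat; via
`mem_of_one_tmul_mem_baseChange`). [cite: Deligne1982HodgeCycles, I §3 (proof of Prop. 3.4)] -/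
theorem eq_zero_of_baseChange_eq_zero {T : Module.End ℚ V} (h : T.baseChange ℂ = 0) : T = 0 := by
  have hmem : T ∈ (⊥ : Submodule ℚ (Module.End ℚ V)) := by
    apply mem_of_one_tmul_mem_baseChange
    rw [Submodule.baseChange_bot]
    have key : ((1 : ℂ) ⊗ₜ[ℚ] T : ℂ ⊗[ℚ] Module.End ℚ V) = 0 := by
      apply (endBaseChangeEquiv V).injective
      rw [endBaseChangeEquiv_tmul, one_smul, map_zero, h]
    rw [key]
    exact Submodule.zero_mem _
  exact (Submodule.mem_bot ℚ).1 hmem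

omit [Module.Finite ℚ V] [HodgeTensorFacts.{u, u}] [Fintype S] [DecidableEq S] in
/-- Base change of a rational multiple: `(q • T)_ℂ = q • T_ℂ` for `q ∈ ℚ`. [cite: Deligne1982HodgeCycles, I §3 (proof of Prop. 3.4)] -/
theorem baseChange_ratCast_smul (q : ℚ) (T : Module.End ℚ V) : (q • T).baseChange ℂ = (q : ℂ) • T.baseChange ℂ := by
  refine TensorProduct.AlgebraTensorModule.ext fun c v => ?_
  rw [LinearMap.baseChange_tmul, LinearMap.smul_apply, LinearMap.smul_apply, LinearMap.baseChange_tmul,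
    TensorProduct.smul_tmul', ← TensorProduct.smul_tmul, Rat.smul_def, smul_eq_mul]

/-! ## §2 `φ³ = qφ` with `q < 0`, and the Hodge types of the eigenvectors of `φ_ℂ` -/

/-- **`φ³ = qφ` with `q ∈ ℚ_{<0}`, and `V^{1,0} ∩ range φ_ℂ`, `V^{0,1} ∩ range φ_ℂ` are the `(±μ)`-eigenspaces of `φ_ℂ`.**
For `X ∈ 𝔥 ∖ End_Hdg(V)` and `dim_ℚ 𝔥 = 4` (polarizable weight-one `H`, degrees in `{0,1}`), the rational central `φ`
(non-zero Hodge endomorphism in `𝔥`, central in `End_Hdg(V)`, `𝔥_ℂ = ℂ(2P−1) ⊕ ℂE ⊕ ℂF ⊕ ℂΦ`, `Φ = φ_ℂ`, `ΦE = ΦF = 0`)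
satisfies, with `[E,F] = α(2P−1) + βΦ`: `β ≠ 0`, `α ≠ 0`, `E F = αP + βΦP`, `F E = α(1−P) − βΦ(1−P)`,
`Φ² = μ Φ (2P−1)` with `μ = −α/β`, `φ³ = qφ` for a rational `q` with `q = μ²` and `q < 0` (second Hodge–Riemann
relation), and every `μ`-eigenvector of `Φ` lies in `V^{1,0} = range P`, every `(−μ)`-eigenvector in `V^{0,1} = ker P`.
So `range φ` carries complex multiplication by `ℚ(φ) ≅ ℚ(√q)` with `V''^{1,0}` the `μ`-eigenspace (Deligne I Ex. 3.7).
[cite: MoonenZarhin1999LowDim, §2] [cite: Deligne1982HodgeCycles, I §3 and Ex. 3.7] [cite: Huybrechts2016K3, Thm. 3.3.9 (proof, p. 67)] -/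
theorem exists_rat_central_cube (H : HodgeStructure V n) (ψ : H.Polarization) (hn : n = 1)
    (e : Module.Basis S ℂ (ℂ ⊗[ℚ] V)) (hF : ∀ a, H.F a = Submodule.span ℂ (e '' {σ | a ≤ deg σ}))
    (hFc : ∀ a, complexConj (H.F a) = Submodule.span ℂ (e '' {σ | deg σ ≤ n - a}))
    (hdeg : ∀ σ, deg σ = 0 ∨ deg σ = 1) {X : Module.End ℚ V} (hX : X ∈ H.hodgeLie) (hXE : X ∉ H.endAlg)
    (h4 : Module.finrank ℚ H.hodgeLie = 4) :
    ∃ φ : Module.End ℚ V, φ ∈ H.hodgeLie ∧ φ ≠ 0 ∧ φ ∈ H.endAlg ∧ (∀ a ∈ H.endAlg, φ * a = a * φ) ∧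
      LinearIndependent ℂ ![(2 : ℂ) • gradingEnd e deg - 1,
        gradingEnd e deg * X.baseChange ℂ * (1 - gradingEnd e deg),
        (1 - gradingEnd e deg) * X.baseChange ℂ * gradingEnd e deg, φ.baseChange ℂ] ∧
      (∀ W ∈ H.hodgeLieC, ∃ c : Fin 4 → ℂ, W = c 0 • ((2 : ℂ) • gradingEnd e deg - 1) +
        c 1 • (gradingEnd e deg * X.baseChange ℂ * (1 - gradingEnd e deg)) +
        c 2 • ((1 - gradingEnd e deg) * X.baseChange ℂ * gradingEnd e deg) + c 3 • φ.baseChange ℂ) ∧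
      φ.baseChange ℂ * (gradingEnd e deg * X.baseChange ℂ * (1 - gradingEnd e deg)) = 0 ∧
      φ.baseChange ℂ * ((1 - gradingEnd e deg) * X.baseChange ℂ * gradingEnd e deg) = 0 ∧
      ∃ (α β : ℂ) (q : ℚ), β ≠ 0 ∧ α ≠ 0 ∧ q < 0 ∧ ((q : ℂ) = (α / β) * (α / β)) ∧ φ * φ * φ = q • φ ∧
        (gradingEnd e deg * X.baseChange ℂ * (1 - gradingEnd e deg)) *
            ((1 - gradingEnd e deg) * X.baseChange ℂ * gradingEnd e deg) -
          ((1 - gradingEnd e deg) * X.baseChange ℂ * gradingEnd e deg) *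
            (gradingEnd e deg * X.baseChange ℂ * (1 - gradingEnd e deg)) =
          α • ((2 : ℂ) • gradingEnd e deg - 1) + β • φ.baseChange ℂ ∧
        (gradingEnd e deg * X.baseChange ℂ * (1 - gradingEnd e deg)) *
            ((1 - gradingEnd e deg) * X.baseChange ℂ * gradingEnd e deg) =
          α • gradingEnd e deg + β • (φ.baseChange ℂ * gradingEnd e deg) ∧
        ((1 - gradingEnd e deg) * X.baseChange ℂ * gradingEnd e deg) *
            (gradingEnd e deg * X.baseChange ℂ * (1 - gradingEnd e deg)) =
          α • (1 - gradingEnd e deg) - β • (φ.baseChange ℂ * (1 - gradingEnd e deg)) ∧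
        φ.baseChange ℂ * φ.baseChange ℂ = (-(α / β)) • (φ.baseChange ℂ * ((2 : ℂ) • gradingEnd e deg - 1)) ∧
        (∀ t, φ.baseChange ℂ t = (-(α / β)) • t → gradingEnd e deg t = t) ∧
        (∀ t, φ.baseChange ℂ t = (α / β) • t → gradingEnd e deg t = 0) := by
  classical
  subst hn
  obtain ⟨φ, hφh, hφ0, hφA, hφcA, hli, hspan, hΦE0, hΦF0, α, β, hβ, hEF⟩ :=
    exists_rat_central_mul_projE_eq_zero H ψ rfl e hF hFc hdeg hX hXE h4
  set P := gradingEnd e deg with hP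
  set Y := X.baseChange ℂ with hY
  set E := P * Y * (1 - P) with hEdef
  set F := (1 - P) * Y * P with hFdef
  have hPP : P * P = P := gradingEnd_mul_gradingEnd_of_deg e hdeg
  have hPE : P * E = E := by rw [hEdef, ← mul_assoc, ← mul_assoc, hPP]
  have hEP : E * P = 0 := by rw [hEdef, mul_assoc (P * Y) (1 - P) P, sub_mul, one_mul, hPP, sub_self, mul_zero]
  have hPF : P * F = 0 := by
    rw [hFdef, mul_assoc (1 - P) Y P, ← mul_assoc P (1 - P) (Y * P), mul_sub, mul_one, hPP, sub_self, zero_mul]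
  have hFP : F * P = F := by rw [hFdef, mul_assoc ((1 - P) * Y) P P, hPP]
  have hΘ' : (2 : ℂ) • P - 1 ∈ H.hodgeLieC := by
    simpa only [Int.cast_one, one_smul] using two_smul_gradingEnd_sub_mem_hodgeLieC H e hF hFc
  set Φ := φ.baseChange ℂ with hΦdef
  have hΦcen : ∀ W ∈ H.hodgeLieC, Φ * W = W * Φ :=
    fun W hW => (commute_baseChange_of_mem_hodgeLieC H hW ⟨φ, hφA⟩).symm
  have hΦΘ : Φ * ((2 : ℂ) • P - 1) = ((2 : ℂ) • P - 1) * Φ := hΦcen _ hΘ'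
  have hΦP : Φ * P = P * Φ := by
    have h := hΦΘ
    rw [mul_sub Φ _ 1, sub_mul _ 1 Φ, mul_one, one_mul, mul_smul_comm, smul_mul_assoc, sub_left_inj] at h
    exact smul_right_injective _ (two_ne_zero' ℂ) h
  -- corners of `[E, F]`
  have hEFc : E * F = α • P + β • (Φ * P) := by
    have h := (corners_comm hPE hEP hPF hFP).1
    rw [hEF, mul_add, add_mul, mul_smul_comm, mul_smul_comm, smul_mul_assoc, smul_mul_assoc, (mul_theta hPP).1, hPP,
      ← hΦP, mul_assoc Φ P P, hPP] at h
    exact h.symm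
  have hFEc : F * E = α • (1 - P) - β • (Φ * (1 - P)) := by
    have h : F * E = E * F - (E * F - F * E) := by rw [sub_sub_cancel]
    rw [h, hEF, hEFc, mul_sub Φ 1 P, mul_one]
    module
  -- `β Φ² = -α Φ (2P - 1)`
  have h1 : α • (Φ * P) + β • (Φ * Φ * P) = 0 := by
    have h : Φ * (E * F) = 0 := by rw [← mul_assoc, hΦE0, zero_mul]
    rw [hEFc, mul_add, mul_smul_comm, mul_smul_comm, ← mul_assoc] at h
    exact h
  have h2 : α • (Φ * (1 - P)) - β • (Φ * Φ * (1 - P)) = 0 := by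
    have h : Φ * (F * E) = 0 := by rw [← mul_assoc, hΦF0, zero_mul]
    rw [hFEc, mul_sub, mul_smul_comm, mul_smul_comm, ← mul_assoc] at h
    exact h
  have hsq : β • (Φ * Φ) = -(α • (Φ * ((2 : ℂ) • P - 1))) := by
    rw [mul_sub (Φ * Φ) 1 P, mul_one] at h2
    rw [mul_sub Φ 1 P, mul_one] at h2
    rw [mul_sub Φ _ 1, mul_one, mul_smul_comm]
    linear_combination (norm := module) h1 - h2
  -- `α ≠ 0`
  have hα : α ≠ 0 := by
    intro hα0
    rw [hα0, zero_smul, neg_zero] at hsq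
    have hΦΦ : Φ * Φ = 0 := (smul_eq_zero.1 hsq).resolve_left hβ
    have hφφ : φ * φ = 0 := eq_zero_of_baseChange_eq_zero (by rw [LinearMap.baseChange_mul, ← hΦdef, hΦΦ])
    exact hφ0 (eq_zero_of_skew_hodge_sq_eq_zero H ψ rfl e hF hFc hdeg hφh hΦP hφφ)
  -- `Φ² = μ Φ (2P-1)`, `Φ³ = μ² Φ`
  set μ : ℂ := -(α / β) with hμdef
  have hμ0 : μ ≠ 0 := by rw [hμdef]; exact neg_ne_zero.2 (div_ne_zero hα hβ)
  have hμμ : μ * μ = (α / β) * (α / β) := by rw [hμdef, neg_mul_neg]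
  have hΦ2 : Φ * Φ = μ • (Φ * ((2 : ℂ) • P - 1)) := by
    calc Φ * Φ = β⁻¹ • (β • (Φ * Φ)) := by rw [smul_smul, inv_mul_cancel₀ hβ, one_smul]
      _ = -((β⁻¹ * α) • (Φ * ((2 : ℂ) • P - 1))) := by rw [hsq, smul_neg, smul_smul]
      _ = (-(β⁻¹ * α)) • (Φ * ((2 : ℂ) • P - 1)) := (neg_smul _ _).symm
      _ = μ • (Φ * ((2 : ℂ) • P - 1)) := by rw [hμdef, inv_mul_eq_div]
  have hΦ3 : Φ * Φ * Φ = (μ * μ) • Φ := by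
    rw [hΦ2, smul_mul_assoc, mul_assoc Φ _ Φ, ← hΦΘ, ← mul_assoc Φ Φ _, hΦ2, smul_mul_assoc, smul_smul,
      mul_assoc Φ _ _, theta_mul_theta hPP, mul_one]
  -- `q ∈ ℚ` with `φ³ = q φ`
  obtain ⟨q, hq⟩ : ∃ q : ℚ, (q : ℂ) = μ * μ :=
    exists_ratCast_eq_of_baseChange_eq_smul (T := φ * φ * φ) hφ0
      (by rw [LinearMap.baseChange_mul, LinearMap.baseChange_mul, ← hΦdef, hΦ3])
  have hq3 : φ * φ * φ = q • φ := by
    rw [← sub_eq_zero]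
    apply eq_zero_of_baseChange_eq_zero
    rw [LinearMap.baseChange_sub, baseChange_ratCast_smul, LinearMap.baseChange_mul, LinearMap.baseChange_mul, ← hΦdef,
      hΦ3, hq, sub_self]
  -- `q < 0` by the second Hodge–Riemann relation
  have hΦ0 : Φ ≠ 0 := fun h => hφ0 (eq_zero_of_baseChange_eq_zero (by rw [← hΦdef, h]))
  obtain ⟨v, hv⟩ : ∃ v, Φ v ≠ 0 := by
    by_contra h
    push Not at h
    exact hΦ0 (LinearMap.ext fun v => by rw [h v, LinearMap.zero_apply])
  have hΦΦy : ∀ y, Φ (Φ (Φ y)) = (q : ℂ) • Φ y := by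
    intro y
    rw [← Module.End.mul_apply, ← Module.End.mul_apply, hΦ3, hq, LinearMap.smul_apply]
  have key : ∀ (p' : ℤ) (y : ℂ ⊗[ℚ] V), y ∈ H.piece p' (1 - p') → Φ y ∈ H.piece p' (1 - p') → y ≠ 0 → Φ y ≠ 0 →
      Φ (Φ y) = (q : ℂ) • y → q < 0 := by
    intro p' y hy hΦy hy0 hΦy0 hqy
    obtain ⟨r₁, hr₁, hre₁⟩ := ψ.pos p' (1 - p') (by ring) y hy hy0
    obtain ⟨r₂, hr₂, hre₂⟩ := ψ.pos p' (1 - p') (by ring) (Φ y) hΦy hΦy0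
    have hskew : ψ.form.baseChange ℂ (Φ y) (conj (Φ y)) = -(q : ℂ) * ψ.form.baseChange ℂ y (conj y) := by
      rw [hΦdef, conj_baseChange, formBaseChange_skew_of_mem_hodgeLieC ψ (H.baseChange_mem_hodgeLieC hφh) y,
        ← conj_baseChange, ← conj_baseChange, ← hΦdef, hqy, conj_smul, map_ratCast, LinearMap.map_smul, smul_eq_mul,
        neg_mul]
    rw [hskew, ← mul_assoc, mul_comm (Complex.I ^ p' * (Complex.I ^ (1 - p'))⁻¹) (-(q : ℂ)), mul_assoc, hre₁] at hre₂
    have hreal : (-(q : ℝ)) * r₁ = r₂ := by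
      have h : ((-(q : ℝ) * r₁ : ℝ) : ℂ) = (r₂ : ℂ) := by rw [← hre₂]; push_cast; ring
      exact_mod_cast h
    have hpos : 0 < -(q : ℝ) := (mul_pos_iff_of_pos_right hr₁).1 (hreal ▸ hr₂)
    exact_mod_cast (neg_pos.1 hpos)
  have hqneg : q < 0 := by
    by_cases hPv : P (Φ v) ≠ 0
    · -- `y = P Φ v = Φ (P v)` of type `(1,0)`
      have hy1 : P (Φ v) ∈ H.piece 1 (1 - 1) := by
        rw [piece_eq_span_of_graded H e hF hFc 1]; exact gradingEnd_apply_mem_span_one e hdeg _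
      have hΦy : Φ (P (Φ v)) = P (Φ (Φ v)) := by
        rw [← Module.End.mul_apply, hΦP, Module.End.mul_apply]
      have hy2 : Φ (P (Φ v)) ∈ H.piece 1 (1 - 1) := by
        rw [hΦy, piece_eq_span_of_graded H e hF hFc 1]; exact gradingEnd_apply_mem_span_one e hdeg _
      have hqy : Φ (Φ (P (Φ v))) = (q : ℂ) • P (Φ v) := by
        rw [hΦy, ← Module.End.mul_apply Φ P, hΦP, Module.End.mul_apply, hΦΦy, map_smul]
      have hΦy0 : Φ (P (Φ v)) ≠ 0 := by
        intro h
        apply hPv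
        have h' : (q : ℂ) • P (Φ v) = 0 := by rw [← hqy, h, map_zero]
        exact (smul_eq_zero.1 h').resolve_left (by rw [hq]; exact mul_ne_zero hμ0 hμ0)
      exact key 1 _ hy1 hy2 hPv hΦy0 hqy
    · push Not at hPv
      have hQv : (1 - P) (Φ v) ≠ 0 := by
        intro h
        apply hv
        rw [LinearMap.sub_apply, Module.End.one_apply, hPv, sub_zero] at h
        exact h
      have hΦQ : Φ * (1 - P) = (1 - P) * Φ := by rw [mul_sub, sub_mul, mul_one, one_mul, hΦP]
      have hy1 : (1 - P) (Φ v) ∈ H.piece 0 (1 - 0) := by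
        rw [piece_eq_span_of_graded H e hF hFc 0]; exact one_sub_gradingEnd_apply_mem_span_zero e hdeg _
      have hΦy : Φ ((1 - P) (Φ v)) = (1 - P) (Φ (Φ v)) := by
        rw [← Module.End.mul_apply, hΦQ, Module.End.mul_apply]
      have hy2 : Φ ((1 - P) (Φ v)) ∈ H.piece 0 (1 - 0) := by
        rw [hΦy, piece_eq_span_of_graded H e hF hFc 0]; exact one_sub_gradingEnd_apply_mem_span_zero e hdeg _
      have hqy : Φ (Φ ((1 - P) (Φ v))) = (q : ℂ) • (1 - P) (Φ v) := by
        rw [hΦy, ← Module.End.mul_apply Φ (1 - P), hΦQ, Module.End.mul_apply, hΦΦy, map_smul]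
      have hΦy0 : Φ ((1 - P) (Φ v)) ≠ 0 := by
        intro h
        apply hQv
        have h' : (q : ℂ) • (1 - P) (Φ v) = 0 := by rw [← hqy, h, map_zero]
        exact (smul_eq_zero.1 h').resolve_left (by rw [hq]; exact mul_ne_zero hμ0 hμ0)
      exact key 0 _ hy1 hy2 hQv hΦy0 hqy
  -- eigenvectors of `Φ`
  have heig : ∀ (t : ℂ ⊗[ℚ] V) (c : ℂ), Φ t = c • t → c * c = μ * μ →
      (μ * μ) • t = (μ * c) • (((2 : ℂ) • P - 1) t) := by
    intro t c ht hc
    have h1 : (Φ * Φ) t = (μ * μ) • t := by rw [Module.End.mul_apply, ht, map_smul, ht, smul_smul, hc]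
    have h2 : (Φ * Φ) t = (μ * c) • (((2 : ℂ) • P - 1) t) := by
      rw [hΦ2, hΦΘ, LinearMap.smul_apply, Module.End.mul_apply, ht, map_smul, smul_smul]
    rw [← h1, h2]
  refine ⟨φ, hφh, hφ0, hφA, hφcA, hli, hspan, hΦE0, hΦF0, α, β, q, hβ, hα, hqneg, by rw [hq, hμμ], hq3, hEF, hEFc,
    hFEc, hΦ2, ?_, ?_⟩
  · intro t ht
    have h := heig t μ ht rfl
    have h' : t = ((2 : ℂ) • P - 1) t := smul_right_injective _ (mul_ne_zero hμ0 hμ0) h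
    rw [LinearMap.sub_apply, LinearMap.smul_apply, Module.End.one_apply, eq_sub_iff_add_eq, ← two_smul ℂ] at h'
    exact (smul_right_injective _ (two_ne_zero' ℂ) h').symm
  · intro t ht
    have hc2 : (α / β) * (α / β) = μ * μ := by rw [hμdef, neg_mul_neg]
    have h := heig t (α / β) ht hc2
    have hneg : μ * (α / β) = -(μ * μ) := by rw [hμdef]; ring
    rw [hneg] at h
    have hns : (-(μ * μ)) • (((2 : ℂ) • P - 1) t) = -((μ * μ) • (((2 : ℂ) • P - 1) t)) := neg_smul _ _
    rw [hns, eq_neg_iff_add_eq_zero, ← smul_add] at h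
    have h' : t + ((2 : ℂ) • P - 1) t = 0 := (smul_eq_zero.1 h).resolve_left (mul_ne_zero hμ0 hμ0)
    rw [LinearMap.sub_apply, LinearMap.smul_apply, Module.End.one_apply, add_sub_cancel] at h'
    exact (smul_eq_zero.1 h').resolve_left (two_ne_zero' ℂ)

end HodgeStructure

end Literature.AlgebraicGeometry.Motives

end
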